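import Summits.NavierStokesRegularity.NavierStokesRegularity.Theses.QuarterTurnRdss
import Literature.Analysis.FluidPDE.TypeIAncientMild

/-!
# Birth skeleton (BC3) for the split piece `TwistedCellConcatenates` — crux `QuarterTurnProfileExists`
# (stmt-NavierStokesRegularity-1100), route `QuarterTurnRdss`, summit NavierStokesRegularity (negative side)

Line `birth` for the BRIDGE of the period-cell split (crux-strategist seat
`cstrat-stmt-NavierStokesRegularity-1100-r1`). The piece says: a twisted cell `v` on the model period
`[-1, -c⁻²]` (jointly continuous, bounded, weakly divergence free, Oseen-mild between all pairs of model
times, closing up under the twisted zoom `v(-c⁻², x) = c R⁻¹ v(-1, cRx)`) with the Type-I bound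
`‖v(t,x)‖ ≤ C₀/(‖x‖ + √(-t))` on the period concatenates to an ancient mild `(c,R)`-RDSS Type-I solution
`u` with `u(-1) = v(-1)`. It is cut into three genuine lemmas, all provable from tree engines:

* `stub_concatenation` (L): the two-sided ℤ-orbit of twisted zooms `u(t,x) = cᵏ(Rᵏ)⁻¹v(c^{2k}t, cᵏRᵏx)` on
  `[-c^{-2k}, -c^{-2k-2}]` (junk `0` for `t ≥ 0`) is jointly continuous on the open past, has weakly
  divergence-free slices, satisfies the Oseen identity between ALL pairs `s < t < 0`, is `(c,R)`-rotated-DSS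
  and agrees with `v` on the model period. Forward half = tree `exists_concatenation_of_periodic_slabs`
  (`RdssPeriodConcatenation.lean`: `oseen_zoom_shift`, `oseenMild_of_chain`, `isWeaklyDivFree_zoom_in`,
  `continuousOn_uncurry_Ico_of_chain`); backward half by the same zoom covariance with `a = c^{-j}`,
  `L = (Rʲ)⁻¹` over finite chains.
* `stub_typeI_of_cellDecay` (M): the bound `C₀/(‖x‖ + √(-t))` is invariant under the twisted zoom
  (cf. `HasTypeIDecay.nsRescale`), so an RDSS field agreeing with a Type-I cell on the model period is
  Type I on the whole past with the SAME constant (ℤ-powers of the zoom; every `t < 0` lands in the period).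
* `stub_duality_of_oseen` (M): a field continuous on the open past, with weakly divergence-free slices, the
  Oseen identity between all pairs and a Type-I bound is an ancient mild solution in the duality sense —
  verbatim the proof of `IsTypeIAncientMild.isMildNSSolutionBetween` (it uses only joint measurability,
  boundedness on `(s,t)` and the tested identities `integral_inner_oseenDuhamel_eq_neg_intervalIntegral`,
  `integral_inner_heatExtension_comm_of_bound`), smoothness never entering.

Composition `TwistedCellConcatenates_of` (kernel-checked, no `sorry`): measurability of slices from joint
continuity, `u(-1) = v(-1)` from the agreement on the period (`-1 ≤ -c⁻²` as `c > 1`).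

Until `route edit --split QuarterTurnProfileExists` has rendered the piece in the route file, the piece is
the LOCAL verbatim copy `TwistedCellConcatenates` below (same text as `children.json` / the glue evidence
file `QuarterTurnRdssQuarterTurnProfileExistsSplit.lean` on stmt-1100); afterwards replace it by
`Summit.NavierStokesRegularity.NavierStokesRegularity.Theses.QuarterTurnRdss.TwistedCellConcatenates`
(`Iff.rfl`).

Disproof used: none — no `Disproof.lean` / Negative lemma exists for this crux (`ledger crux ls`, 2026-08-17).
-/

noncomputable section

namespace Summit.NavierStokesRegularity.NavierStokesRegularity.Cruxes.TwistedCellConcatenates.Birth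

open MeasureTheory Set Function Filter
open Literature.Analysis.FluidPDE

set_option linter.dupNamespace false

/-! ## The piece (local verbatim copy) and the three statements of the line -/

/-- LOCAL verbatim copy of the split piece `QuarterTurnRdss.TwistedCellConcatenates` (children.json). -/
def TwistedCellConcatenates : Prop :=
  ∀ c : ℝ, 1 < c → ∀ R : EuclideanSpace ℝ (Fin 3) ≃ₗᵢ[ℝ] EuclideanSpace ℝ (Fin 3), ∀ v : ℝ → EuclideanSpace ℝ (Fin 3) → EuclideanSpace ℝ (Fin 3), (ContinuousOn (Function.uncurry v) (Set.Icc (-1 : ℝ) (-(c ^ 2)⁻¹) ×ˢ Set.univ) ∧ (∃ M : ℝ, ∀ t ∈ Set.Icc (-1 : ℝ) (-(c ^ 2)⁻¹), ∀ x, ‖v t x‖ ≤ M) ∧ (∀ t ∈ Set.Icc (-1 : ℝ) (-(c ^ 2)⁻¹), Literature.Analysis.FluidPDE.IsWeaklyDivFree (v t)) ∧ (∀ s t : ℝ, -1 ≤ s → s < t → t ≤ -(c ^ 2)⁻¹ → ∀ x, v t x = Literature.Analysis.FluidPDE.heatFlow (v s) (t - s) x - Literature.Analysis.FluidPDE.oseenDuhamel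 1 s v v t x) ∧ (∀ x, v (-(c ^ 2)⁻¹) x = c • R.symm (v (-1) (c • R x)))) → ∀ C₀ : ℝ, (∀ t ∈ Set.Icc (-1 : ℝ) (-(c ^ 2)⁻¹), ∀ x, ‖v t x‖ ≤ C₀ / (‖x‖ + Real.sqrt (-t))) → ∃ u : ℝ → EuclideanSpace ℝ (Fin 3) → EuclideanSpace ℝ (Fin 3), Literature.Analysis.FluidPDE.IsAncientMildSolution 1 u ∧ (∀ t < 0, AEStronglyMeasurable (u t) volume) ∧ Literature.Analysis.FluidPDE.IsRotatedDSS c R u ∧ Literature.Analysis.FluidPDE.HasTypeIDecay C₀ u ∧ u (-1) = v (-1)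

/-- Statement of stub 1 (two-sided concatenation in the Oseen gauge). -/
def Concatenation : Prop :=
  ∀ c : ℝ, 1 < c → ∀ (R : EuclideanSpace ℝ (Fin 3) ≃ₗᵢ[ℝ] EuclideanSpace ℝ (Fin 3)) (v : ℝ → EuclideanSpace ℝ (Fin 3) → EuclideanSpace ℝ (Fin 3)), (ContinuousOn (Function.uncurry v) (Set.Icc (-1 : ℝ) (-(c ^ 2)⁻¹) ×ˢ Set.univ) ∧ (∃ M : ℝ, ∀ t ∈ Set.Icc (-1 : ℝ) (-(c ^ 2)⁻¹), ∀ x, ‖v t x‖ ≤ M) ∧ (∀ t ∈ Set.Icc (-1 : ℝ) (-(c ^ 2)⁻¹), Literature.Analysis.FluidPDE.IsWeaklyDivFree (v t)) ∧ (∀ s t : ℝ, -1 ≤ s → s < t → t ≤ -(c ^ 2)⁻¹ → ∀ x, v t x = Literature.Analysis.FluidPDE.heatFlow (v s) (t - s) x - Literature.Analysis.FluidPDE.oseenDuhamel 1 s v v t x) ∧ (∀ x, v (-(c ^ 2)⁻¹) x = c • R.symm (v (-1) (c • R x)))) → ∃ u : ℝ → EuclideanSpace ℝ (Fin 3) → EuclideanSpace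 ℝ (Fin 3), ContinuousOn (Function.uncurry u) (Set.Iio 0 ×ˢ Set.univ) ∧ (∀ t < 0, Literature.Analysis.FluidPDE.IsWeaklyDivFree (u t)) ∧ (∀ s t : ℝ, s < t → t < 0 → ∀ x, u t x = Literature.Analysis.FluidPDE.heatFlow (u s) (t - s) x - Literature.Analysis.FluidPDE.oseenDuhamel 1 s u u t x) ∧ Literature.Analysis.FluidPDE.IsRotatedDSS c R u ∧ (∀ t ∈ Set.Icc (-1 : ℝ) (-(c ^ 2)⁻¹), u t = v t)

/-- Statement of stub 2 (the Type-I bound propagates along the twisted zoom). -/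
def TypeIOfCellDecay : Prop :=
  ∀ c : ℝ, 1 < c → ∀ (R : EuclideanSpace ℝ (Fin 3) ≃ₗᵢ[ℝ] EuclideanSpace ℝ (Fin 3)) (u v : ℝ → EuclideanSpace ℝ (Fin 3) → EuclideanSpace ℝ (Fin 3)) (C₀ : ℝ), Literature.Analysis.FluidPDE.IsRotatedDSS c R u → (∀ t ∈ Set.Icc (-1 : ℝ) (-(c ^ 2)⁻¹), u t = v t) → (∀ t ∈ Set.Icc (-1 : ℝ) (-(c ^ 2)⁻¹), ∀ x, ‖v t x‖ ≤ C₀ / (‖x‖ + Real.sqrt (-t))) → Literature.Analysis.FluidPDE.HasTypeIDecay C₀ u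

/-- Statement of stub 3 (Oseen gauge ⇒ duality-form ancient mild, continuous version). -/
def DualityOfOseen : Prop :=
  ∀ (u : ℝ → EuclideanSpace ℝ (Fin 3) → EuclideanSpace ℝ (Fin 3)) (C₀ : ℝ), ContinuousOn (Function.uncurry u) (Set.Iio 0 ×ˢ Set.univ) → (∀ t < 0, Literature.Analysis.FluidPDE.IsWeaklyDivFree (u t)) → (∀ s t : ℝ, s < t → t < 0 → ∀ x, u t x = Literature.Analysis.FluidPDE.heatFlow (u s) (t - s) x - Literature.Analysis.FluidPDE.oseenDuhamel 1 s u u t x) → Literature.Analysis.FluidPDE.HasTypeIDecay C₀ u → Literature.Analysis.FluidPDE.IsAncientMildSolution 1 u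

namespace Registered

/-- Alias keyed by the registered stub name. -/
abbrev stub_concatenation : Prop := Concatenation
/-- Alias keyed by the registered stub name. -/
abbrev stub_typeI_of_cellDecay : Prop := TypeIOfCellDecay
/-- Alias keyed by the registered stub name. -/
abbrev stub_duality_of_oseen : Prop := DualityOfOseen

end Registered

/-! ## Registered stubs (the ONLY `sorry`s of the file; literal signatures) -/

/-- **Stub 1 (L): two-sided concatenation of a twisted cell in the Oseen gauge.** For `c > 1`, a linear
isometry `R` and a twisted cell `v` on `[-1, -c⁻²]`, there is a field `u` on the past, jointly continuous
on `(-∞,0) × ℝ³`, with weakly divergence-free slices, satisfying the Oseen identity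
`u(t) = e^{(t-s)Δ}u(s) − B¹_s(u,u)(t)` between all pairs `s < t < 0`, `(c,R)`-rotated-DSS (for all `t`:
junk `0` on `t ≥ 0`), and equal to `v` on the model period. Proof route: ℤ-orbit of twisted zooms;
forward half is the tree's `exists_concatenation_of_periodic_slabs`, backward half the same covariance
(`oseen_zoom_shift` with `a = c^{-j}`, `L = (Rʲ)⁻¹`) and `oseenMild_of_chain` on finite windows.
[sources: BradshawTsai2017CPDE §1; ChaeWolf2017RemovingDSS Def. 1.1; KNSS2009 §4 (4.4); tree RdssPeriodConcatenation.lean] -/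
theorem stub_concatenation :
    ∀ c : ℝ, 1 < c → ∀ (R : EuclideanSpace ℝ (Fin 3) ≃ₗᵢ[ℝ] EuclideanSpace ℝ (Fin 3)) (v : ℝ → EuclideanSpace ℝ (Fin 3) → EuclideanSpace ℝ (Fin 3)), (ContinuousOn (Function.uncurry v) (Set.Icc (-1 : ℝ) (-(c ^ 2)⁻¹) ×ˢ Set.univ) ∧ (∃ M : ℝ, ∀ t ∈ Set.Icc (-1 : ℝ) (-(c ^ 2)⁻¹), ∀ x, ‖v t x‖ ≤ M) ∧ (∀ t ∈ Set.Icc (-1 : ℝ) (-(c ^ 2)⁻¹), Literature.Analysis.FluidPDE.IsWeaklyDivFree (v t)) ∧ (∀ s t : ℝ, -1 ≤ s → s < t → t ≤ -(c ^ 2)⁻¹ → ∀ x, v t x = Literature.Analysis.FluidPDE.heatFlow (v s) (t - s) x - Literature.Analysis.FluidPDE.oseenDuhamel 1 s v v t x) ∧ (∀ x, v (-(c ^ 2)⁻¹) x = c • R.symm (v (-1) (c • R x)))) → ∃ u : ℝ → EuclideanSpace ℝ (Fin 3) → EuclideanSpace ℝ (Fin 3), ContinuousOn (Function.uncurry u)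 (Set.Iio 0 ×ˢ Set.univ) ∧ (∀ t < 0, Literature.Analysis.FluidPDE.IsWeaklyDivFree (u t)) ∧ (∀ s t : ℝ, s < t → t < 0 → ∀ x, u t x = Literature.Analysis.FluidPDE.heatFlow (u s) (t - s) x - Literature.Analysis.FluidPDE.oseenDuhamel 1 s u u t x) ∧ Literature.Analysis.FluidPDE.IsRotatedDSS c R u ∧ (∀ t ∈ Set.Icc (-1 : ℝ) (-(c ^ 2)⁻¹), u t = v t) := by
  sorry

/-- **Stub 2 (M): the Type-I space–time bound propagates along the twisted zoom.** If `u` is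
`(c,R)`-rotated-DSS (`c > 1`), agrees with `v` on the model period, and `v` obeys
`‖v(t,x)‖ ≤ C₀/(‖x‖ + √(-t))` there, then `HasTypeIDecay C₀ u`: every `t < 0` is `c^{2k}t' ` with `t'`
in the period, and `‖cᵏ(Rᵏ)⁻¹v(c^{2k}t, cᵏRᵏx)‖ ≤ cᵏC₀/(cᵏ‖x‖ + cᵏ√(-t))` (cf. `HasTypeIDecay.nsRescale`).
[sources: KNSS2009 §1 (1.6) scale invariance; tree SelfSimilar.lean] -/
theorem stub_typeI_of_cellDecay :
    ∀ c : ℝ, 1 < c → ∀ (R : EuclideanSpace ℝ (Fin 3) ≃ₗᵢ[ℝ] EuclideanSpace ℝ (Fin 3)) (u v : ℝ → EuclideanSpace ℝ (Fin 3) → EuclideanSpace ℝ (Fin 3)) (C₀ : ℝ), Literature.Analysis.FluidPDE.IsRotatedDSS c R u → (∀ t ∈ Set.Icc (-1 : ℝ) (-(c ^ 2)⁻¹), u t = v t) → (∀ t ∈ Set.Icc (-1 : ℝ) (-(c ^ 2)⁻¹), ∀ x, ‖v t x‖ ≤ C₀ / (‖x‖ + Real.sqrt (-t))) → Literature.Analysis.FluidPDE.HasTypeIDecay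 C₀ u := by
  sorry

/-- **Stub 3 (M): Oseen gauge ⇒ duality-form ancient mild (continuous version).** A field continuous on
the open past with weakly divergence-free slices, the Oseen identity between all pairs `s < t < 0` and a
Type-I bound is `IsAncientMildSolution 1 u`. Proof route: copy `IsTypeIAncientMild.isMildNSSolutionBetween`
(joint measurability from continuity, the bound `C₀/√(-t)` on `(s,t)`, tested identities of the heat
and Oseen–Duhamel terms); `0 ≤ C₀` unless the statement is vacuous.
[sources: LemarieRieusset2016 Thm 6.1; KNSS2009 Rem. 4.1; tree TypeIAncientMild.lean] -/
theorem stub_duality_of_oseen :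
    ∀ (u : ℝ → EuclideanSpace ℝ (Fin 3) → EuclideanSpace ℝ (Fin 3)) (C₀ : ℝ), ContinuousOn (Function.uncurry u) (Set.Iio 0 ×ˢ Set.univ) → (∀ t < 0, Literature.Analysis.FluidPDE.IsWeaklyDivFree (u t)) → (∀ s t : ℝ, s < t → t < 0 → ∀ x, u t x = Literature.Analysis.FluidPDE.heatFlow (u s) (t - s) x - Literature.Analysis.FluidPDE.oseenDuhamel 1 s u u t x) → Literature.Analysis.FluidPDE.HasTypeIDecay C₀ u → Literature.Analysis.FluidPDE.IsAncientMildSolution 1 u := by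
  sorry

/-! ## Composition (kernel-checked; no `sorry` in the closure of `TwistedCellConcatenates_of`) -/

/-- **Composition: the three stubs imply the piece `TwistedCellConcatenates`.** -/
theorem TwistedCellConcatenates_of (h₁ : Registered.stub_concatenation)
    (h₂ : Registered.stub_typeI_of_cellDecay) (h₃ : Registered.stub_duality_of_oseen) :
    TwistedCellConcatenates := by
  dsimp only [Registered.stub_concatenation, Concatenation, Registered.stub_typeI_of_cellDecay,
    TypeIOfCellDecay, Registered.stub_duality_of_oseen, DualityOfOseen] at h₁ h₂ h₃
  intro c hc R v hcell C₀ hdec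
  obtain ⟨u, hcont, hdiv, hos, hrdss, hagree⟩ := h₁ c hc R v hcell
  have hTI : HasTypeIDecay C₀ u := h₂ c hc R u v C₀ hrdss hagree hdec
  have hanc : IsAncientMildSolution 1 u := h₃ u C₀ hcont hdiv hos hTI
  refine ⟨u, hanc, fun t ht => ?_, hrdss, hTI, ?_⟩
  · -- slices of a jointly continuous field are continuous, hence a.e. strongly measurable
    have hslice : Continuous (u t) :=
      (hcont.comp_continuous (continuous_const.prodMk continuous_id)
        fun x => ⟨ht, Set.mem_univ _⟩).congr fun _ => rfl
    exact hslice.aestronglyMeasurable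
  · -- `-1` lies in the model period since `c > 1`
    have hc2 : (1 : ℝ) ≤ c ^ 2 := by nlinarith
    have hq : (c ^ 2)⁻¹ ≤ 1 := inv_le_one_of_one_le₀ hc2
    exact hagree (-1) ⟨le_rfl, by linarith⟩

/-! ## Wiring check -/

/-- The sorried stubs, with their LITERAL signatures, feed `TwistedCellConcatenates_of` exactly as stated. -/
theorem twistedCellConcatenates_of_stubs : TwistedCellConcatenates :=
  TwistedCellConcatenates_of stub_concatenation stub_typeI_of_cellDecay stub_duality_of_oseen

end Summit.NavierStokesRegularity.NavierStokesRegularity.Cruxes.TwistedCellConcatenates.Birth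

end
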